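import Mathlib
import HarnessLib
import Summits.Ventures.LatticeQCDFlow.Scaling.U1IdentityFlowVolumeLaw
import Summits.Ventures.LatticeQCDFlow.Scaling.IMHHoldingTimeESS

/-!
# LatticeQCDFlow / Scaling — the untrained 2-d U(1) sampler, II: the equilibrium HOLDING TIME of the
# exact chain is `(I₀(2β)/I₀(β)²)^V` within a factor `2`, and `ā ≥ (8/9)·(I₀(β)²/I₀(2β))^V`

HONEST FRAMING: exact (Metropolis-corrected) sampling algorithms for lattice gauge theory;
figures of merit are autocorrelation/cost numbers at stated couplings and volumes; no
continuum-physics claim.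

Venture `LatticeQCDFlow` (cell pub-lqcd), topic `Scaling`; FANOUT row 3 (`s0-u1-a`, S0-B
implementation A: the 2-d U(1) flow sampler, GEN-12).  NEW WORK of the cell (closed forms, no
numerics), continuing `Scaling/U1IdentityFlowVolumeLaw` (imported: the product model of `V`
independent plaquette angles on `(0, 2π]`, Wilson density `p_β = e^{β cos θ}/Z(β)` against the Haar
model `q = 1/(2π)`, `∫ p_β²/q = I₀(2β)/I₀(β)²`).  Row 2's general-space laws in the `rejCurve`
vocabulary (`Scaling/IMHHoldingTimeESS`: `∫ w/(1 − λ(b)) ∈ [W₂/Z, 2W₂/Z]`; Part II of the 8/9 law,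
`meanAccept_ge_eight_ninths_ESS`: `∫ (1 − λ(b)) w ≥ (8/9)Z³/W₂`) are instantiated on the product
space `(Fin V → (0, 2π], ⊗ Lebesgue)` with `w = P = ⊗ p_β` (so `Z = 1`), `q = Q = ⊗ (1/2π)`,
`b = P/Q`, `W₂ = ∫ (P/Q)·P = (I₀(2β)/I₀(β)²)^V`:

* `integrable_u1Wilson_sq_div`, `u1Product_weightMoment_integrable`, **`u1Product_weightMoment_eq`**
  — `W₂ = ∫ (P/Q)·P d(⊗μ) = (I₀(2β)/I₀(β)²)^V`;
* **`u1IdentityFlow_holdingTime_mem_Icc`** — the equilibrium mean holding time of the exact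
  untrained chain, `∫ P/(1 − λ(P/Q)) d(⊗μ) = E_π[1/a]`, lies in
  `[(I₀(2β)/I₀(β)²)^V, 2·(I₀(2β)/I₀(β)²)^V]`;
* **`u1IdentityFlow_meanAccept_rejCurve_ge`** — `ā = ∫ (1 − λ(P/Q)) P d(⊗μ) ≥ (8/9)·(I₀(β)²/I₀(2β))^V`.

Reading (value-free; no number of ours is computed or implied): started in equilibrium, the
untrained exact sampler of the factorised 2-d U(1) model waits on average between
`(I₀(2β)/I₀(β)²)^V` and twice that many proposals before moving — exponential in the number of
plaquettes at every `β ≠ 0` — while still accepting at rate at least `(8/9)·(I₀(β)²/I₀(2β))^V`.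
NOT CLAIMED: the periodic-torus constraint; any value at the cell's `(β, L)`; nothing re-scored.
-/

namespace Summit.Ventures.LatticeQCDFlow.Theory2

open MeasureTheory Real Set Finset
open Literature.Analysis.FunctionSpaces (besselI besselI_zero_pos)
open Summit.Ventures.LatticeQCDFlow.Scoring (onePlaquetteZ onePlaquetteZ_pos onePlaquetteZ_eq_besselI)
open Summit.Ventures.LatticeQCDFlow.Exactness (rejCurve)

/-! ## The second weight moment of the product model -/

/-- The one-plaquette integrand `p_β²/q` is integrable on `(0, 2π]`. [folklore] -/
theorem integrable_u1Wilson_sq_div (β : ℝ) :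
    Integrable (fun θ : ℝ => (Real.exp (β * Real.cos θ) / onePlaquetteZ β) ^ 2 / (1 / (2 * π)))
      (volume.restrict (Ioc (0 : ℝ) (2 * π))) := by
  have e : ∀ θ : ℝ, (Real.exp (β * Real.cos θ) / onePlaquetteZ β) ^ 2 / (1 / (2 * π))
      = 2 * π / onePlaquetteZ β ^ 2 * Real.exp (2 * β * Real.cos θ) := by
    intro θ
    rw [div_pow, exp_mul_cos_sq]
    field_simp
  simp_rw [e]
  exact (integrableOn_exp_mul_cos (2 * β)).const_mul _

section Plaquettes

variable {ι : Type*} [Fintype ι]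

/-- Pointwise: `(P/Q)·P = ∏ᵢ p_β(xᵢ)²/q`. [folklore] -/
theorem u1Product_weightMoment_integrand (β : ℝ) (x : ι → ℝ) :
    (∏ i, Real.exp (β * Real.cos (x i)) / onePlaquetteZ β) / (∏ _i : ι, (1 / (2 * π) : ℝ))
        * ∏ i, Real.exp (β * Real.cos (x i)) / onePlaquetteZ β
      = ∏ i, ((Real.exp (β * Real.cos (x i)) / onePlaquetteZ β) ^ 2 / (1 / (2 * π))) := by
  rw [← prod_div_distrib, ← prod_mul_distrib]
  exact prod_congr rfl fun i _ => by ring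

/-- `(P/Q)·P` is integrable on the product space. [folklore] -/
theorem u1Product_weightMoment_integrable (β : ℝ) :
    Integrable (fun x : ι → ℝ => (∏ i, Real.exp (β * Real.cos (x i)) / onePlaquetteZ β)
        / (∏ _i : ι, (1 / (2 * π) : ℝ)) * ∏ i, Real.exp (β * Real.cos (x i)) / onePlaquetteZ β)
      (Measure.pi fun _ : ι => volume.restrict (Ioc (0 : ℝ) (2 * π))) := by
  simp_rw [u1Product_weightMoment_integrand]
  exact Integrable.fintype_prod_dep (μ := fun _ : ι => volume.restrict (Ioc (0 : ℝ) (2 * π)))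
    fun _ => integrable_u1Wilson_sq_div β

/-- **`W₂ = ∫ (P/Q)·P d(⊗μ) = (I₀(2β)/I₀(β)²)^V`** for the product model (`V = card ι`). [ours] -/
theorem u1Product_weightMoment_eq (β : ℝ) :
    ∫ x, (∏ i, Real.exp (β * Real.cos (x i)) / onePlaquetteZ β)
        / (∏ _i : ι, (1 / (2 * π) : ℝ)) * ∏ i, Real.exp (β * Real.cos (x i)) / onePlaquetteZ β
        ∂(Measure.pi fun _ : ι => volume.restrict (Ioc (0 : ℝ) (2 * π)))
      = (besselI 0 (2 * β) / besselI 0 β ^ 2) ^ Fintype.card ι := by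
  simp_rw [u1Product_weightMoment_integrand]
  rw [integral_fintype_prod_eq_prod (μ := fun _ : ι => volume.restrict (Ioc (0 : ℝ) (2 * π)))
    (fun (_ : ι) (θ : ℝ) => (Real.exp (β * Real.cos θ) / onePlaquetteZ β) ^ 2 / (1 / (2 * π))),
    prod_const, card_univ, integral_u1Wilson_sq_div]

/-- **THE HOLDING TIME OF THE UNTRAINED CHAIN.**  For the product model of `V = card ι` independent
plaquettes, the equilibrium mean holding time of the exact sampler proposing from the product Haar
prior, `∫ P/(1 − λ(P/Q)) d(⊗μ)` (`λ = rejCurve`, row 2), lies in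
`[(I₀(2β)/I₀(β)²)^V, 2·(I₀(2β)/I₀(β)²)^V]` (row 2's `holdingTime_mem_Icc` with `Z = 1`,
`W₂ = (I₀(2β)/I₀(β)²)^V`). [ours] -/
theorem u1IdentityFlow_holdingTime_mem_Icc (β : ℝ) :
    ∫ x, (∏ i : ι, Real.exp (β * Real.cos (x i)) / onePlaquetteZ β)
        / (1 - rejCurve (Measure.pi fun _ : ι => volume.restrict (Ioc (0 : ℝ) (2 * π)))
            (fun x : ι → ℝ => ∏ i, Real.exp (β * Real.cos (x i)) / onePlaquetteZ β)
            (fun _ : ι → ℝ => ∏ _i : ι, (1 / (2 * π) : ℝ))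
            ((∏ i, Real.exp (β * Real.cos (x i)) / onePlaquetteZ β) / ∏ _i : ι, (1 / (2 * π) : ℝ)))
        ∂(Measure.pi fun _ : ι => volume.restrict (Ioc (0 : ℝ) (2 * π)))
      ∈ Set.Icc ((besselI 0 (2 * β) / besselI 0 β ^ 2) ^ Fintype.card ι)
          (2 * (besselI 0 (2 * β) / besselI 0 β ^ 2) ^ Fintype.card ι) := by
  set ν : Measure ℝ := volume.restrict (Ioc (0 : ℝ) (2 * π)) with hν
  obtain ⟨-, hPm, hPi, hP1⟩ := piDensity_facts (ι := ι) (μ := fun _ : ι => ν)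
    (p := fun _ θ => Real.exp (β * Real.cos θ) / onePlaquetteZ β) (fun _ θ => (u1Wilson_pos β θ).le)
    (fun _ => measurable_u1Wilson β) fun _ => integrable_u1Wilson β
  obtain ⟨-, hQm, hQi, hQ1⟩ := piDensity_facts (ι := ι) (μ := fun _ : ι => ν)
    (p := fun _ _ => (1 / (2 * π) : ℝ)) (fun _ _ => by positivity) (fun _ => measurable_const)
    fun _ => integrable_u1Haar
  rw [prod_eq_one fun i _ => integral_u1Haar] at hQ1
  rw [prod_eq_one fun i _ => integral_u1Wilson β] at hP1
  have hPpos : ∀ x : ι → ℝ, 0 < ∏ i, Real.exp (β * Real.cos (x i)) / onePlaquetteZ β :=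
    fun x => prod_pos fun i _ => u1Wilson_pos β (x i)
  have hQpos : ∀ _x : ι → ℝ, (0 : ℝ) < ∏ _i : ι, (1 / (2 * π) : ℝ) :=
    fun _ => prod_pos fun i _ => by positivity
  have h := holdingTime_mem_Icc (μ := Measure.pi fun _ : ι => ν) hPpos hPm hPi hQpos hQm hQi hQ1
    (u1Product_weightMoment_integrable β)
  rw [hP1, u1Product_weightMoment_eq, div_one, div_one] at h
  exact h

/-- **`ā ≥ (8/9)·(I₀(β)²/I₀(2β))^V` IN ROW 2's FORM**: for the product model, the equilibrium
acceptance of the exact untrained sampler written with the rejection curve,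
`∫ (1 − λ(P/Q)) P d(⊗μ)`, is at least `(8/9)·(I₀(β)²/I₀(2β))^V`. [ours] -/
theorem u1IdentityFlow_meanAccept_rejCurve_ge (β : ℝ) :
    8 / 9 * (besselI 0 β ^ 2 / besselI 0 (2 * β)) ^ Fintype.card ι
      ≤ ∫ x, (1 - rejCurve (Measure.pi fun _ : ι => volume.restrict (Ioc (0 : ℝ) (2 * π)))
            (fun x : ι → ℝ => ∏ i, Real.exp (β * Real.cos (x i)) / onePlaquetteZ β)
            (fun _ : ι → ℝ => ∏ _i : ι, (1 / (2 * π) : ℝ))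
            ((∏ i, Real.exp (β * Real.cos (x i)) / onePlaquetteZ β) / ∏ _i : ι, (1 / (2 * π) : ℝ)))
          * ∏ i : ι, Real.exp (β * Real.cos (x i)) / onePlaquetteZ β
        ∂(Measure.pi fun _ : ι => volume.restrict (Ioc (0 : ℝ) (2 * π))) := by
  set ν : Measure ℝ := volume.restrict (Ioc (0 : ℝ) (2 * π)) with hν
  obtain ⟨-, hPm, hPi, hP1⟩ := piDensity_facts (ι := ι) (μ := fun _ : ι => ν)
    (p := fun _ θ => Real.exp (β * Real.cos θ) / onePlaquetteZ β) (fun _ θ => (u1Wilson_pos β θ).le)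
    (fun _ => measurable_u1Wilson β) fun _ => integrable_u1Wilson β
  obtain ⟨-, hQm, hQi, hQ1⟩ := piDensity_facts (ι := ι) (μ := fun _ : ι => ν)
    (p := fun _ _ => (1 / (2 * π) : ℝ)) (fun _ _ => by positivity) (fun _ => measurable_const)
    fun _ => integrable_u1Haar
  rw [prod_eq_one fun i _ => integral_u1Haar] at hQ1
  rw [prod_eq_one fun i _ => integral_u1Wilson β] at hP1
  have hPpos : ∀ x : ι → ℝ, 0 < ∏ i, Real.exp (β * Real.cos (x i)) / onePlaquetteZ β :=
    fun x => prod_pos fun i _ => u1Wilson_pos β (x i)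
  have hQpos : ∀ _x : ι → ℝ, (0 : ℝ) < ∏ _i : ι, (1 / (2 * π) : ℝ) :=
    fun _ => prod_pos fun i _ => by positivity
  have h := meanAccept_ge_eight_ninths_ESS (μ := Measure.pi fun _ : ι => ν) hPpos hPm hPi hQpos
    hQm hQi hQ1 (u1Product_weightMoment_integrable β)
  rw [hP1, u1Product_weightMoment_eq] at h
  have hI2 : 0 < besselI 0 (2 * β) := besselI_zero_pos _
  have hI : 0 < besselI 0 β := besselI_zero_pos _
  calc 8 / 9 * (besselI 0 β ^ 2 / besselI 0 (2 * β)) ^ Fintype.card ι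
      = 8 * 1 ^ 3 / (9 * (besselI 0 (2 * β) / besselI 0 β ^ 2) ^ Fintype.card ι) := by
        rw [div_pow, div_pow, one_pow]
        field_simp
    _ ≤ _ := h

end Plaquettes

end Summit.Ventures.LatticeQCDFlow.Theory2
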